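import Mathlib
import HarnessLib
import Summits.HubbardSuperconductivity.HubbardSuperconductivity.Theorems.FunctionFieldCertificateWindowInfraredBoundEngineB
import Summits.HubbardSuperconductivity.HubbardSuperconductivity.Theorems.FunctionFieldCertificateWindowInfraredBoundStubPgdFirstVariation
import Summits.HubbardSuperconductivity.HubbardSuperconductivity.Theorems.FunctionFieldCertificateWindowInfraredBoundStubPgdRegularisedMomentClosure

/-!
# Crux `WindowInfraredBound` (stmt-HubbardSuperconductivity-1089) — engine C: the energy-form (Gaussian-domination)
# line composed down to its two physics inputs

Line `pair-gaussian-domination-energy-form` (`Cruxes/WindowInfraredBound/Lines/pair_gaussian_domination_energy_form.lean`,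
card `Cruxes/WindowInfraredBound/Ideas/pair-gaussian-domination-energy-form.md`). The line TRANSFERS the crux to
C⁺_λ, a ONE-SIDED, OWN-BOTTOM, `λ_q`-REGULARISED GROUND-ENERGY GAUSSIAN DOMINATION in the `d`-wave pair channel of
the doped Hubbard torus: for every window momentum `m ≠ 0` and every real source amplitude `t`, the sourced
sector-compressed Hamiltonian `H − μ∓N̂ − t(Δ_d(m) + Δ_d(m)ᴴ)` on `(N_L∓2, 0) ⊔ (N_L, 0)` — `μ∓` the one-sided pair
chemical potentials that put the neighbouring bottom `c₀|q_m|²` ABOVE the `N_L` bottom — never dips below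
`E(N_L) − μ∓N_L` by more than `C_χ t² L²/|q_m|²` (the Kennedy–Lieb–Shastry (GD) shape with `1/E_q ↦ L²/|q_m|²`).

This file composes the line, sorry-free, down to exactly TWO hypotheses (both OPEN physics inputs, claimed nowhere):
(GD) = C⁺_λ (`hGD`, verbatim the registered stub `stub_pairGaussianDomination`) and (Ch) the charging floor
`pairGap H N_L ≥ −κ/L` (`hCh`, verbatim the registered stub `stub_chargingFloor`, shared with engine B):

* the LANDED first variation `stub_pgdFirstVariation` (p96685) turns C⁺_λ at a sector ground state `ψ` into the
  `λ`-regularised variational torus pair stiffness (T_λ∓) with `X = C_χL²/|q_m|²`, `λ = c₀|q_m|²`;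
* the LANDED regularised Pitaevskii–Stringari closure `stub_pgdRegularisedMomentClosure` (p96461), fed with the
  LANDED budgets F1 (`stub_doubleCommBound` at `μ = 0`), F2 (`WcbcsSsbToTorusLRO.stub_pairCommutatorBudget`),
  F3 (`wib_twoParticleCost_holds`) and (Ch), gives `‖Δψ‖² ≤ 2√((B₁ + B₃B₂)X) + (4κ/L + 2λ)X`;
* `goldstoneShape_of_regularisedClosure`: hence the Goldstone shape
  `S_ψ(m)·|q_m| ≤ 2√((C₁ + C₃C₂)C_χ) + 2κC_χ/π + 2c₀C_χη` on the window (`L|q_m| ≥ 2π`, `|q_m| ≤ η`);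
* `wib_of_goldstoneShape` (landed) ⇒ `wib_of_pairGaussianDomination_of_chargingFloor`.

Position of C⁺_λ (for the record): a FLAT structure factor `S_ψ ≤ K` implies C⁺_λ trivially (`χ ≤ ‖Δψ‖²/λ_q`), and
C⁺_λ implies the Goldstone shape (this file); both physics inputs fail exactly on the events that would refute the
crux (phase separation with a paired component, a pair-density wave with `|Q| → 0`). No reflection positivity is
available off half filling; nothing here claims (GD) or (Ch). No definition, no named fact, no sorry.

Sources: Kennedy–Lieb–Shastry, PRL 61 (1988) 2582 and J. Stat. Phys. 53 (1988) 1019 (ground-state Gaussian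
domination ⇒ infrared bound); Dyson–Lieb–Simon, J. Stat. Phys. 18 (1978) 335; Pitaevskii–Stringari, J. Low Temp.
Phys. 85 (1991) 377; Lin–Hirsch–Scalapino, PRB 37 (1988) 7359 (one-sided pair chemical potentials).
-/

namespace Summit.HubbardSuperconductivity.HubbardSuperconductivity.Theorems.WindowInfraredBound

-- summit = problem name (single-conjunct summit, D-0017): `HubbardSuperconductivity` occurs twice in the path
set_option linter.dupNamespace false

open Literature.MathematicalPhysics.QuantumLattice Literature.Probability.LatticeModels Matrix Finset
open scoped ComplexOrder ComplexConjugate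
open Summit.HubbardSuperconductivity.HubbardSuperconductivity.Theses

/-! ## The composition -/

/-- **Real endgame of the regularised closure.** If `s ≤ 2M(L²/r) + (4(κ/L) + 2(c₀Q))(C L²/Q)` with
`Q = r²`, `r > 0`, `L > 0`, `2π ≤ L r`, `r ≤ η` and `C, κ, c₀ ≥ 0`, then
`(s/L²)·r ≤ 2M + 2κC/π + 2c₀Cη`. [folklore] -/
theorem shape_real_endgame {s M L r Q C κ c₀ η : ℝ} (hr : 0 < r) (hL : 0 < L) (hQ : Q = r ^ 2)
    (hLr : 2 * Real.pi ≤ L * r) (hrη : r ≤ η) (hC : 0 ≤ C) (hκ : 0 ≤ κ) (hc₀ : 0 ≤ c₀)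
    (hs : s ≤ 2 * M * (L ^ 2 / r) + (4 * (κ / L) + 2 * (c₀ * Q)) * (C * L ^ 2 / Q)) :
    s / L ^ 2 * r ≤ 2 * M + 2 * κ * C / Real.pi + 2 * c₀ * C * η := by
  have hL2 : 0 < L ^ 2 := by positivity
  have hQ0 : 0 < Q := by rw [hQ]; positivity
  have hπ := Real.pi_pos
  -- multiply `hs` by `r/L² ≥ 0`
  have h := mul_le_mul_of_nonneg_right hs (by positivity : (0:ℝ) ≤ r / L ^ 2)
  have e0 : s / L ^ 2 * r = s * (r / L ^ 2) := by ring
  have e1 : 2 * M * (L ^ 2 / r) * (r / L ^ 2) = 2 * M := by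
    field_simp
  have e2 : (4 * (κ / L) + 2 * (c₀ * Q)) * (C * L ^ 2 / Q) * (r / L ^ 2) =
      4 * κ * C / (L * r) + 2 * c₀ * C * r := by
    rw [hQ]
    field_simp
  rw [add_mul, e1, e2] at h
  rw [e0]
  -- `4κC/(Lr) ≤ 4κC/(2π) = 2κC/π` and `2c₀Cr ≤ 2c₀Cη`
  have h3 : 4 * κ * C / (L * r) ≤ 2 * κ * C / Real.pi := by
    rw [div_le_div_iff₀ (by positivity) hπ]
    calc 4 * κ * C * Real.pi = 2 * κ * C * (2 * Real.pi) := by ring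
      _ ≤ 2 * κ * C * (L * r) := mul_le_mul_of_nonneg_left hLr (by positivity)
  have h4 : 2 * c₀ * C * r ≤ 2 * c₀ * C * η := mul_le_mul_of_nonneg_left hrη (by positivity)
  linarith [h, h3, h4]

/-- **Goldstone shape from the regularised closure, one state, one momentum.** For a normalised
`(N, 0)`-sector ground state `ψ` of `H = hubbardTorus 2 L 1 U`, `N ≥ 2`, a window momentum `0 < |q_m| ≤ η`,
IF the regularised stiffness bounds (T_λ∓) hold with `X = C_X L²/|q_m|²`, `λ = c₀|q_m|²`, and the budgets
(F1) `≤ C₁L²`, (F2) `≤ C₂L²`, (F3) `≤ C₃`, (Ch) `pairGap ≥ −κ/L` hold, THEN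
`S_ψ(m)·|q_m| ≤ 2√((C₁ + C₃C₂)C_X) + 2κC_X/π + 2c₀C_Xη` (via `stub_pgdRegularisedMomentClosure` and
`L|q_m| ≥ 2π`). Pitaevskii–Stringari (1991); Kennedy–Lieb–Shastry (1988) for the shape. [folklore] -/
theorem goldstoneShape_of_regularisedClosure {U : ℝ} {L : ℕ} [NeZero L] {N : ℕ} (hN : 2 ≤ N)
    {ψ : Fock (Orb (FermionTorus 2 L))}
    (hψ : IsGroundStateInSector (hubbardTorus 2 L 1 U) N 0 ψ) (hψ1 : star ψ ⬝ᵥ ψ = 1)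
    {m : TorusSite 2 L} (hm : m ≠ 0) {C_X C₁ C₂ C₃ κ c₀ η : ℝ} (hCX : 0 ≤ C_X) (hC₁ : 0 ≤ C₁)
    (hC₂ : 0 ≤ C₂) (hC₃ : 0 ≤ C₃) (hκ : 0 ≤ κ) (hc₀ : 0 ≤ c₀) (hmη : momentumNormSq L m ≤ η ^ 2)
    (hη : 0 < η)
    (hTm : ∀ w : Fock (Orb (FermionTorus 2 L)), w ∈ szSector (Λ := FermionTorus 2 L) (N - 2) 0 →
      2 * (star w ⬝ᵥ (pairFieldAt dWaveFormFactor L m *ᵥ ψ)).re -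
        ((star w ⬝ᵥ (hubbardTorus 2 L 1 U *ᵥ w)).re -
          ((hubbardTorus 2 L 1 U).minEnergyOn (szSector (N - 2) 0) - c₀ * momentumNormSq L m) *
            (star w ⬝ᵥ w).re) ≤
        C_X * (L : ℝ) ^ 2 / momentumNormSq L m)
    (hTp : ∀ w : Fock (Orb (FermionTorus 2 L)), w ∈ szSector (Λ := FermionTorus 2 L) (N + 2) 0 →
      2 * (star w ⬝ᵥ ((pairFieldAt dWaveFormFactor L m)ᴴ *ᵥ ψ)).re -
        ((star w ⬝ᵥ (hubbardTorus 2 L 1 U *ᵥ w)).re -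
          ((hubbardTorus 2 L 1 U).minEnergyOn (szSector (N + 2) 0) - c₀ * momentumNormSq L m) *
            (star w ⬝ᵥ w).re) ≤
        C_X * (L : ℝ) ^ 2 / momentumNormSq L m)
    (hF1 : (star ψ ⬝ᵥ (((pairFieldAt dWaveFormFactor L m)ᴴ *
        (hubbardTorus 2 L 1 U * pairFieldAt dWaveFormFactor L m -
          pairFieldAt dWaveFormFactor L m * hubbardTorus 2 L 1 U) -
        (hubbardTorus 2 L 1 U * pairFieldAt dWaveFormFactor L m -
          pairFieldAt dWaveFormFactor L m * hubbardTorus 2 L 1 U) *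
        (pairFieldAt dWaveFormFactor L m)ᴴ) *ᵥ ψ)).re ≤ C₁ * (L : ℝ) ^ 2)
    (hF2 : |(star ψ ⬝ᵥ (((pairFieldAt dWaveFormFactor L m)ᴴ * pairFieldAt dWaveFormFactor L m -
        pairFieldAt dWaveFormFactor L m * (pairFieldAt dWaveFormFactor L m)ᴴ) *ᵥ ψ)).re| ≤
        C₂ * (L : ℝ) ^ 2)
    (hF3 : |(hubbardTorus 2 L 1 U).minEnergyOn (szSector N 0) -
        (hubbardTorus 2 L 1 U).minEnergyOn (szSector (N - 2) 0)| ≤ C₃)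
    (hC : -(κ / (L : ℝ)) ≤ pairGap (hubbardTorus 2 L 1 U) N) :
    pairStructureFactor dWaveFormFactor L ψ m * Real.sqrt (momentumNormSq L m) ≤
      2 * Real.sqrt ((C₁ + C₃ * C₂) * C_X) + 2 * κ * C_X / Real.pi + 2 * c₀ * C_X * η := by
  have hL0 : (0 : ℝ) < L := Nat.cast_pos.2 (Nat.pos_of_ne_zero (NeZero.ne L))
  have hL2 : (0 : ℝ) < (L : ℝ) ^ 2 := by positivity
  have hQ : 0 < momentumNormSq L m :=
    (momentumNormSq_nonneg m).lt_of_ne' (fun h0 => hm ((momentumNormSq_eq_zero_iff m).1 h0))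
  set Q := momentumNormSq L m with hQdef
  set r := Real.sqrt Q with hrdef
  have hr : 0 < r := Real.sqrt_pos.2 hQ
  have hrQ : r ^ 2 = Q := Real.sq_sqrt hQ.le
  have hLr : 2 * Real.pi ≤ (L : ℝ) * r := by
    have h := wib_div_le_sqrt_momentumNormSq (L := L) hm
    rw [div_le_iff₀ hL0] at h
    linarith [h]
  have hrη : r ≤ η := by
    rw [hrdef, ← Real.sqrt_sq hη.le]
    exact Real.sqrt_le_sqrt hmη
  -- the regularised moment closure with `X = C_X L²/Q`, `B₁ = C₁L²`, `B₂ = C₂L²`, `B₃ = C₃`, `g = κ/L`,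
  -- `lam = c₀ Q`
  have hX : 0 ≤ C_X * (L : ℝ) ^ 2 / Q := by positivity
  have hMC := stub_pgdRegularisedMomentClosure L U N hN ψ hψ hψ1 m (C_X * (L : ℝ) ^ 2 / Q)
    (C₁ * (L : ℝ) ^ 2) (C₂ * (L : ℝ) ^ 2) C₃ (κ / (L : ℝ)) (c₀ * Q) hX (by positivity) (by positivity) hC₃
    (by positivity) (by positivity) hTm hTp hF1 hF2 hF3 hC
  set s := (star (pairFieldAt dWaveFormFactor L m *ᵥ ψ) ⬝ᵥ (pairFieldAt dWaveFormFactor L m *ᵥ ψ)).re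
    with hsdef
  set a := (C₁ + C₃ * C₂) * C_X with hadef
  have ha : 0 ≤ a := by positivity
  -- simplify the square root: `(B₁ + B₃B₂) X = (√a · L²/r)²`
  have hsq : (C₁ * (L : ℝ) ^ 2 + C₃ * (C₂ * (L : ℝ) ^ 2)) * (C_X * (L : ℝ) ^ 2 / Q) =
      (Real.sqrt a * ((L : ℝ) ^ 2 / r)) ^ 2 := by
    rw [mul_pow, Real.sq_sqrt ha, div_pow, hrQ, hadef]
    field_simp
  have hsqrt : Real.sqrt ((C₁ * (L : ℝ) ^ 2 + C₃ * (C₂ * (L : ℝ) ^ 2)) * (C_X * (L : ℝ) ^ 2 / Q)) =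
      Real.sqrt a * ((L : ℝ) ^ 2 / r) := by
    rw [hsq, Real.sqrt_sq (by positivity)]
  rw [hsqrt] at hMC
  rw [pairStructureFactor_apply, ← hsdef]
  have hs' : s ≤ 2 * Real.sqrt a * ((L : ℝ) ^ 2 / r) +
      (4 * (κ / (L : ℝ)) + 2 * (c₀ * Q)) * (C_X * (L : ℝ) ^ 2 / Q) := by
    have e : 2 * (Real.sqrt a * ((L : ℝ) ^ 2 / r)) = 2 * Real.sqrt a * ((L : ℝ) ^ 2 / r) := by ring
    rw [← e]
    exact hMC
  exact shape_real_endgame hr hL0 hrQ.symm hLr hrη hCX hκ hc₀ hs'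

/-- **Engine C ⇒ the crux.** HYPOTHESES, both pointwise in `(U, δ)` and eventually along even sides:
(GD) = C⁺_λ, the one-sided own-bottom `λ_q`-regularised energy-form Gaussian domination in the `d`-wave pair channel
(verbatim the line's registered stub `stub_pairGaussianDomination`), and (Ch) the charging floor `pairGap H N_L ≥ −κ/L`
(verbatim `stub_chargingFloor`). CONCLUSION: `FunctionFieldCertificate.WindowInfraredBound`, via the landed first
variation (p96685), the landed regularised moment closure (p96461), the landed budgets F1/F2/F3 and
`wib_of_goldstoneShape`. Both hypotheses are OPEN physics inputs (no reflection positivity off half filling).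
Kennedy–Lieb–Shastry (1988); Pitaevskii–Stringari (1991). [folklore] -/
theorem wib_of_pairGaussianDomination_of_chargingFloor :
    (∀ U : ℝ, 0 < U → ∀ δ ∈ Set.Ioo (0:ℝ) (1 / 2), ∃ C_χ c₀ η : ℝ, 0 ≤ C_χ ∧ 0 ≤ c₀ ∧ 0 < η ∧ ∃ L₀ : ℕ,
        ∀ (L : ℕ) [NeZero L], L₀ ≤ L → Even L → ∀ m : TorusSite 2 L, m ≠ 0 → momentumNormSq L m ≤ η ^ 2 →
          ∀ t : ℝ,
            ((hubbardTorus 2 L 1 U).minEnergyOn (szSector (2 * ⌊(1 - δ) * (L : ℝ) ^ 2 / 2⌋₊) 0) -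
                ((hubbardTorus 2 L 1 U).minEnergyOn (szSector (2 * ⌊(1 - δ) * (L : ℝ) ^ 2 / 2⌋₊) 0) -
                    (hubbardTorus 2 L 1 U).minEnergyOn (szSector (2 * ⌊(1 - δ) * (L : ℝ) ^ 2 / 2⌋₊ - 2) 0) +
                    c₀ * momentumNormSq L m) / 2 * ((2 * ⌊(1 - δ) * (L : ℝ) ^ 2 / 2⌋₊ : ℕ) : ℝ) -
                C_χ * (L : ℝ) ^ 2 / momentumNormSq L m * t ^ 2 ≤
              (hubbardTorus 2 L 1 U -
                ((((hubbardTorus 2 L 1 U).minEnergyOn (szSector (2 * ⌊(1 - δ) * (L : ℝ) ^ 2 / 2⌋₊) 0) -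
                    (hubbardTorus 2 L 1 U).minEnergyOn (szSector (2 * ⌊(1 - δ) * (L : ℝ) ^ 2 / 2⌋₊ - 2) 0) +
                    c₀ * momentumNormSq L m) / 2 : ℝ) : ℂ) •
                  (totalNumber : Matrix (Finset (Orb (FermionTorus 2 L))) (Finset (Orb (FermionTorus 2 L))) ℂ) -
                (t : ℂ) • (pairFieldAt dWaveFormFactor L m + (pairFieldAt dWaveFormFactor L m)ᴴ)).minEnergyOn
                (szSector (2 * ⌊(1 - δ) * (L : ℝ) ^ 2 / 2⌋₊ - 2) 0 ⊔
                  szSector (2 * ⌊(1 - δ) * (L : ℝ) ^ 2 / 2⌋₊) 0)) ∧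
            ((hubbardTorus 2 L 1 U).minEnergyOn (szSector (2 * ⌊(1 - δ) * (L : ℝ) ^ 2 / 2⌋₊) 0) -
                ((hubbardTorus 2 L 1 U).minEnergyOn (szSector (2 * ⌊(1 - δ) * (L : ℝ) ^ 2 / 2⌋₊ + 2) 0) -
                    (hubbardTorus 2 L 1 U).minEnergyOn (szSector (2 * ⌊(1 - δ) * (L : ℝ) ^ 2 / 2⌋₊) 0) -
                    c₀ * momentumNormSq L m) / 2 * ((2 * ⌊(1 - δ) * (L : ℝ) ^ 2 / 2⌋₊ : ℕ) : ℝ) -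
                C_χ * (L : ℝ) ^ 2 / momentumNormSq L m * t ^ 2 ≤
              (hubbardTorus 2 L 1 U -
                ((((hubbardTorus 2 L 1 U).minEnergyOn (szSector (2 * ⌊(1 - δ) * (L : ℝ) ^ 2 / 2⌋₊ + 2) 0) -
                    (hubbardTorus 2 L 1 U).minEnergyOn (szSector (2 * ⌊(1 - δ) * (L : ℝ) ^ 2 / 2⌋₊) 0) -
                    c₀ * momentumNormSq L m) / 2 : ℝ) : ℂ) •
                  (totalNumber : Matrix (Finset (Orb (FermionTorus 2 L))) (Finset (Orb (FermionTorus 2 L))) ℂ) -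
                (t : ℂ) • (pairFieldAt dWaveFormFactor L m + (pairFieldAt dWaveFormFactor L m)ᴴ)).minEnergyOn
                (szSector (2 * ⌊(1 - δ) * (L : ℝ) ^ 2 / 2⌋₊) 0 ⊔
                  szSector (2 * ⌊(1 - δ) * (L : ℝ) ^ 2 / 2⌋₊ + 2) 0))) →
    (∀ U : ℝ, 0 < U → ∀ δ ∈ Set.Ioo (0:ℝ) (1 / 2), ∃ κ : ℝ, 0 ≤ κ ∧ ∃ L₀ : ℕ, ∀ (L : ℕ) [NeZero L],
        L₀ ≤ L → Even L → -(κ / (L : ℝ)) ≤ pairGap (hubbardTorus 2 L 1 U) (2 * ⌊(1 - δ) * (L : ℝ) ^ 2 / 2⌋₊)) →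
    FunctionFieldCertificate.WindowInfraredBound := by
  intro hGD hCh
  refine wib_of_goldstoneShape fun U hU δ hδ => ?_
  obtain ⟨C_X, c₀, η, hCX, hc₀, hη, L₁, hGD⟩ := hGD U hU δ hδ
  obtain ⟨κ, hκ, L₂, hCh⟩ := hCh U hU δ hδ
  obtain ⟨C₃, hC₃, L₃, hF3⟩ := wib_twoParticleCost_holds U hU δ hδ
  obtain ⟨C, hC, hB⟩ := stub_doubleCommBound U hU
  obtain ⟨B, hB0, hPCB⟩ := WcbcsSsbToTorusLRO.stub_pairCommutatorBudget
  refine ⟨2 * Real.sqrt ((C + C₃ * B) * C_X) + 2 * κ * C_X / Real.pi + 2 * c₀ * C_X * η, η,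
    by positivity, hη, max (max L₁ L₂) (max L₃ 2), fun L _ hL₀ hev ψ hψ1 hψ m hm0 hmη => ?_⟩
  have hL₁ : L₁ ≤ L := le_trans (le_max_left _ _) ((le_max_left _ _).trans hL₀)
  have hL₂ : L₂ ≤ L := le_trans (le_max_right _ _) ((le_max_left _ _).trans hL₀)
  have hL₃ : L₃ ≤ L := le_trans (le_max_left _ _) ((le_max_right _ _).trans hL₀)
  have hL2 : 2 ≤ L := le_trans (le_max_right _ _) ((le_max_right _ _).trans hL₀)
  have hN : 2 ≤ 2 * ⌊(1 - δ) * (L : ℝ) ^ 2 / 2⌋₊ := wib_two_le_summitFilling hδ hL2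
  -- C⁺_λ at this `L`, `m`, all `t`; first variation ⇒ (T_λ∓)
  have hGD' := hGD L hL₁ hev m hm0 hmη
  obtain ⟨hTm, hTp⟩ := stub_pgdFirstVariation L U (2 * ⌊(1 - δ) * (L : ℝ) ^ 2 / 2⌋₊) hN ψ hψ hψ1 m
    (C_X * (L : ℝ) ^ 2 / momentumNormSq L m) (c₀ * momentumNormSq L m)
  have hTm' := hTm (fun t => (hGD' t).1)
  have hTp' := hTp (fun t => (hGD' t).2)
  -- (F1) at `μ = 0`
  have hF1 : (star ψ ⬝ᵥ (((pairFieldAt dWaveFormFactor L m)ᴴ *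
        (hubbardTorus 2 L 1 U * pairFieldAt dWaveFormFactor L m -
          pairFieldAt dWaveFormFactor L m * hubbardTorus 2 L 1 U) -
        (hubbardTorus 2 L 1 U * pairFieldAt dWaveFormFactor L m -
          pairFieldAt dWaveFormFactor L m * hubbardTorus 2 L 1 U) *
        (pairFieldAt dWaveFormFactor L m)ᴴ) *ᵥ ψ)).re ≤ C * (L : ℝ) ^ 2 := by
    have h := hB L 0 m ψ
    rw [hubbardTorusWith_zero, hψ1, Complex.one_re, mul_one, abs_zero, add_zero, mul_one] at h
    exact (le_abs_self _).trans h
  -- (F2)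
  have hF2 : |(star ψ ⬝ᵥ (((pairFieldAt dWaveFormFactor L m)ᴴ * pairFieldAt dWaveFormFactor L m -
        pairFieldAt dWaveFormFactor L m * (pairFieldAt dWaveFormFactor L m)ᴴ) *ᵥ ψ)).re| ≤
        B * (L : ℝ) ^ 2 := by
    have h := hPCB L m ψ
    rwa [hψ1, Complex.one_re, mul_one] at h
  exact goldstoneShape_of_regularisedClosure hN hψ hψ1 hm0 hCX hC hB0 hC₃ hκ hc₀ hmη hη
    hTm' hTp' hF1 hF2 (hF3 L hL₃ hev) (hCh L hL₂ hev)

/-- Engine C for the `KacWindowPenalty` copy of the crux (the same proposition, `wib_functionField_iff_kac`). [folklore] -/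
theorem kacWib_of_pairGaussianDomination_of_chargingFloor
    (hGD : ∀ U : ℝ, 0 < U → ∀ δ ∈ Set.Ioo (0:ℝ) (1 / 2), ∃ C_χ c₀ η : ℝ, 0 ≤ C_χ ∧ 0 ≤ c₀ ∧ 0 < η ∧ ∃ L₀ : ℕ,
        ∀ (L : ℕ) [NeZero L], L₀ ≤ L → Even L → ∀ m : TorusSite 2 L, m ≠ 0 → momentumNormSq L m ≤ η ^ 2 →
          ∀ t : ℝ,
            ((hubbardTorus 2 L 1 U).minEnergyOn (szSector (2 * ⌊(1 - δ) * (L : ℝ) ^ 2 / 2⌋₊) 0) -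
                ((hubbardTorus 2 L 1 U).minEnergyOn (szSector (2 * ⌊(1 - δ) * (L : ℝ) ^ 2 / 2⌋₊) 0) -
                    (hubbardTorus 2 L 1 U).minEnergyOn (szSector (2 * ⌊(1 - δ) * (L : ℝ) ^ 2 / 2⌋₊ - 2) 0) +
                    c₀ * momentumNormSq L m) / 2 * ((2 * ⌊(1 - δ) * (L : ℝ) ^ 2 / 2⌋₊ : ℕ) : ℝ) -
                C_χ * (L : ℝ) ^ 2 / momentumNormSq L m * t ^ 2 ≤
              (hubbardTorus 2 L 1 U -
                ((((hubbardTorus 2 L 1 U).minEnergyOn (szSector (2 * ⌊(1 - δ) * (L : ℝ) ^ 2 / 2⌋₊) 0) -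
                    (hubbardTorus 2 L 1 U).minEnergyOn (szSector (2 * ⌊(1 - δ) * (L : ℝ) ^ 2 / 2⌋₊ - 2) 0) +
                    c₀ * momentumNormSq L m) / 2 : ℝ) : ℂ) •
                  (totalNumber : Matrix (Finset (Orb (FermionTorus 2 L))) (Finset (Orb (FermionTorus 2 L))) ℂ) -
                (t : ℂ) • (pairFieldAt dWaveFormFactor L m + (pairFieldAt dWaveFormFactor L m)ᴴ)).minEnergyOn
                (szSector (2 * ⌊(1 - δ) * (L : ℝ) ^ 2 / 2⌋₊ - 2) 0 ⊔
                  szSector (2 * ⌊(1 - δ) * (L : ℝ) ^ 2 / 2⌋₊) 0)) ∧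
            ((hubbardTorus 2 L 1 U).minEnergyOn (szSector (2 * ⌊(1 - δ) * (L : ℝ) ^ 2 / 2⌋₊) 0) -
                ((hubbardTorus 2 L 1 U).minEnergyOn (szSector (2 * ⌊(1 - δ) * (L : ℝ) ^ 2 / 2⌋₊ + 2) 0) -
                    (hubbardTorus 2 L 1 U).minEnergyOn (szSector (2 * ⌊(1 - δ) * (L : ℝ) ^ 2 / 2⌋₊) 0) -
                    c₀ * momentumNormSq L m) / 2 * ((2 * ⌊(1 - δ) * (L : ℝ) ^ 2 / 2⌋₊ : ℕ) : ℝ) -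
                C_χ * (L : ℝ) ^ 2 / momentumNormSq L m * t ^ 2 ≤
              (hubbardTorus 2 L 1 U -
                ((((hubbardTorus 2 L 1 U).minEnergyOn (szSector (2 * ⌊(1 - δ) * (L : ℝ) ^ 2 / 2⌋₊ + 2) 0) -
                    (hubbardTorus 2 L 1 U).minEnergyOn (szSector (2 * ⌊(1 - δ) * (L : ℝ) ^ 2 / 2⌋₊) 0) -
                    c₀ * momentumNormSq L m) / 2 : ℝ) : ℂ) •
                  (totalNumber : Matrix (Finset (Orb (FermionTorus 2 L))) (Finset (Orb (FermionTorus 2 L))) ℂ) -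
                (t : ℂ) • (pairFieldAt dWaveFormFactor L m + (pairFieldAt dWaveFormFactor L m)ᴴ)).minEnergyOn
                (szSector (2 * ⌊(1 - δ) * (L : ℝ) ^ 2 / 2⌋₊) 0 ⊔
                  szSector (2 * ⌊(1 - δ) * (L : ℝ) ^ 2 / 2⌋₊ + 2) 0)))
    (hCh : ∀ U : ℝ, 0 < U → ∀ δ ∈ Set.Ioo (0:ℝ) (1 / 2), ∃ κ : ℝ, 0 ≤ κ ∧ ∃ L₀ : ℕ, ∀ (L : ℕ) [NeZero L],
        L₀ ≤ L → Even L → -(κ / (L : ℝ)) ≤ pairGap (hubbardTorus 2 L 1 U) (2 * ⌊(1 - δ) * (L : ℝ) ^ 2 / 2⌋₊))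
    : KacWindowPenalty.WindowInfraredBound :=
  wib_functionField_iff_kac.1 (wib_of_pairGaussianDomination_of_chargingFloor hGD hCh)

end Summit.HubbardSuperconductivity.HubbardSuperconductivity.Theorems.WindowInfraredBound
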